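import Mathlib
import Literature.MathematicalPhysics.QuantumFieldTheory.Balaban1983to89.LatticeFieldCalculus

/-!
# `BalabanImbrieJaffe1984to88.BIJ85AxialPropagator411` — T. Bałaban, J. Imbrie, A. Jaffe, *Renormalization of the Higgs
model: minimizers, propagators and the stability of mean field theory*, Commun. Math. Phys. **97** (1985) 299–329
[BalabanImbrieJaffe1985]: Sect. 4.1 p. 309 — the axial gauge propagator `G_{k,Ax}` (4.1.1) and the k-scale axial gauge
`δ_{k,Ax}` (4.1.2), typed; the Gaussian identity behind (4.1.1) PROVED

statement-level skeleton of published theorems with citation tags; proofs where landed; nothing here is a claim about the Yang–Mills mass gap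

PDF held: `paper:balaban1985-cmp97-bij-higgs-minimizers` (journal page = PDF page + 298); p. 309 [PDF 11] read on the render
`run/shared/lean/pub/pub-balaban/t4/b2b-balaban-t4-lit2/renders/bij1985/1985-cmp97-bij-higgs-minimizers-p011-x2.png`.

THE PRINTED TEXT (p. 309, verbatim).  *"4.1. The Axial Gauge Propagator and Minimizer.  We require an axial gauge propagator
to express the effective action. Define G_{k,Ax} by the functional integral
exp(½⟨J, G_{k,Ax}J⟩) = Z_{k,Ax}^{−1} ∫𝒟A δ(Q_kA) δ_{k,Ax}(A) exp(−½‖∂A‖² + ⟨A, J⟩). (4.1.1)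
Here the normalization factor Z_{k,Ax} can be computed by setting J = 0. The averaging operator Q_k is the k-fold composition of
the 1-step averaging operators Q for bond variables, Q_k = (Q)^k. It follows that Q_k is given by the formula (2.13), where L is
replaced by L^k. Finally, the axial gauge is fixed by the delta function δ_{k,Ax}(A) ≡ Π_{j=0}^{k−1} δ_{Ax}(Q_jA). (4.1.2) The j^th
factor in the product acts on the L^jη = L^{j−k} lattice. It sets bond field averages Q_jA to zero on contours Γ_{yx} defined in
the L^jη lattice in the same way that the axial gauge was fixed in Sect. 3 on contours in the unit lattice.  The reader may
wonder whether ∂ has zero modes on the subspace of gauge fields satisfying Q_kA = 0 and satisfying the axial gauge condition.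
Such zero modes do not occur, and as a consequence the integral (4.1.1) is convergent also for noncompact gauge fields. …
The propagator G_{k,Ax} itself is the second moment of the measure exp(−½‖∂A‖²), restricted to the space of gauge fields
which satisfy the k^th axial gauge condition and condition on the k^th average fields vanishing. We do not know a simple
operator theoretic definition of G_{k,Ax}, and we generally establish the properties of the propagator by appealing to the
definition (4.1.1)."*

WHAT IS TYPED / PROVED (SKELETON row `C1.Eq4.1.1-4.1.2`, lit-balaban HOME `run/shared/lean/pub/lit-balaban/`; seat p09, lead
re-point G.5-22; unit `lit-balaban-p09`).
* §1 — the finite-dimensional Gaussian fact that (4.1.1) rests on, PROVED for an arbitrary real finite-dimensional inner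
  product space `W` ("the space of gauge fields which satisfy the k-th axial gauge condition and Q_kA = 0") and a linear map
  `S : W → F` (∂ restricted to it): with `formOp S = S*S` and `formInv S = (S*S)⁻¹` (`Ring.inverse`),
  `∫_W e^{−½‖Sw‖² + ⟨w,b⟩} dw = e^{½⟨b,(S*S)⁻¹b⟩} ∫_W e^{−½‖Sw‖²} dw` whenever S has no zero modes (`gaussian_source`:
  completing the square + translation invariance of the volume), and then `0 < ∫_W e^{−½‖Sw‖²} < ∞`
  (`partition_integrable`, `partition_pos`: *"the integral (4.1.1) is convergent also for noncompact gauge fields"*).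
* §2 — **(4.1.1)** for a constraint subspace `V` of the η-bond fields `E` and the curl `D : E → F`: the partition function
  `Z V D` (*"computed by setting J = 0"*), the generating function `gen V D J`, the printed DEFINING PROPERTY
  `IsAxialPropagator V D G :⟺ ∀ J, exp(½⟨J,GJ⟩) = Z⁻¹·gen(J)` (verbatim (4.1.1)), and an operator-theoretic formula for the
  second moment, `axialPropagator V D = ι_V (ι_V* D*D ι_V)⁻¹ ι_V*`, which SATISFIES (4.1.1) when D has no zero modes on V
  (`isAxialPropagator_axialPropagator`); (4.1.1) determines the quadratic form of G (`quadForm_eq_of_isAxialPropagator`).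
* §3 — **(4.1.2)** on the series' V1 lattice calculus `…Balaban1983to89.LatticeFieldCalculus` (tori `Setup.Site P j`, bond
  fields `VecField P j V`, one-step average `bondAvg` = Q of (2.13) = [Balaban1984PropagatorsI] (1.11), k-fold `bondAvgIter`
  = Q_k, axial gauge `IsAxial` = (3.4) of this paper = [Balaban1984PropagatorsI] (1.10)): `deltaAx k A :⟺ ∀ j < k,
  IsAxial (Q_j A)`, with the PRODUCT/RESTRICTION identities `deltaAx_zero`, `deltaAx_succ` (δ_{k+1,Ax} = δ_{k,Ax}·δ_{Ax}(Q_k·)),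
  `deltaAx_one` (with Q_{k+1} = Q∘Q_k, *"Q_k = (Q)^k"* = the tree's `B5Eq120IterProof.bondAvgIter_succ`), and the support of `δ(Q_kA)δ_{k,Ax}(A)` as a LINEAR
  SUBSPACE `constraint411 k : Submodule ℝ (VecField P 0 V)` (linearity of Q, Q_k and of the contour functionals A(Γ_{y,x}),
  proved here: `bondAvg_add/smul`, `stairSum_add/smul`, …).
* §4 — **(4.1.1) ON THE TORUS**: §2 instantiated with `E` = the η-bond fields `VecField P 0 ℝ` (as the Euclidean space
  `BondSpace P`, identification `toE`), the printed pairing `⟨A, J⟩ = Σ_b η^d A_b J_b` = `LatticeFieldCalculus.bondPairing w`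
  (`w = η^d`), `½‖∂A‖²` = `LatticeFieldCalculus.curlAction w c` (`c = η⁻¹` inside `∂`; `curlOp`, `half_norm_curlOp_sq`),
  `V` = `constraint411 k` (`V411`): the torus propagator `torusPropagator w c k` and **`eq411_torus`** — (4.1.1) verbatim,
  `exp(½⟨J, G_{k,Ax}J⟩) = Z_{k,Ax}⁻¹ ∫_{Q_kA=0, δ_{k,Ax}(A)} exp(−½‖∂A‖² + ⟨A,J⟩) dA` for every J, and `Z_{k,Ax} > 0`
  (`Z_torus`), GIVEN the p. 309 no-zero-modes claim as the hypothesis `hD` (∂A = 0 ∧ Q_kA = 0 ∧ δ_{k,Ax}(A) ⇒ A = 0).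
NOT DONE HERE.  The no-zero-modes INPUT `hD` is the p. 309 claim, kernel-proved for k = 1 on the corner-block carriers of ℤ^d
by `…BIJ85NoZeroModes309Proof.noZeroModes_k1` (seat p33, reserve R4, p243150) and left open for k > 1 in print (*"we leave
out the details"*); it is carried as a hypothesis, not re-proved, on the torus carriers (centred blocks of `Setup`).
(4.1.3)–(4.1.5) stay on the carrier `BIJ85Sect4Statements.GaugeRG`.
Convention flag inherited from `LatticeFieldCalculus.IsAxial` (CENTRED blocks of `Setup`; BIJ anchors blocks at the corner,
(2.4)) — DIVERGENCE F3 of the pub-balaban cell, no adjudication here.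
-/

namespace Literature.MathematicalPhysics.QuantumFieldTheory.BalabanImbrieJaffe1984to88.BIJ85AxialPropagator411

open MeasureTheory
open scoped RealInnerProductSpace

noncomputable section

/-! ## §1  The Gaussian fact behind (4.1.1): sources, completing the square, convergence -/

section Gaussian

variable {W F : Type*} [NormedAddCommGroup W] [InnerProductSpace ℝ W] [FiniteDimensional ℝ W]
  [NormedAddCommGroup F] [InnerProductSpace ℝ F] [FiniteDimensional ℝ F]

/-- The operator `S*S` of the quadratic form `‖Sw‖² = ⟨w, S*S w⟩` (for (4.1.1): ∂*∂ compressed to the constraint space).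
[cite: BalabanImbrieJaffe1985, (4.1.1) p.309] -/
def formOp (S : W →ₗ[ℝ] F) : W →ₗ[ℝ] W := LinearMap.adjoint S ∘ₗ S

/-- Its inverse `(S*S)⁻¹` (the `Ring.inverse` in `End W`; the honest inverse exactly when S has no zero modes).
[cite: BalabanImbrieJaffe1985, (4.1.1) p.309] -/
def formInv (S : W →ₗ[ℝ] F) : W →ₗ[ℝ] W := Ring.inverse (formOp S)

/-- `⟨v, S*S w⟩ = ⟨Sv, Sw⟩`. [folklore] -/
private theorem inner_formOp (S : W →ₗ[ℝ] F) (v w : W) : ⟪v, formOp S w⟫ = ⟪S v, S w⟫ := by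
  unfold formOp
  rw [LinearMap.comp_apply, LinearMap.adjoint_inner_right]

/-- `⟨w, S*S w⟩ = ‖Sw‖²`. [folklore] -/
private theorem inner_formOp_self (S : W →ₗ[ℝ] F) (w : W) : ⟪w, formOp S w⟫ = ‖S w‖ ^ 2 := by
  rw [inner_formOp, real_inner_self_eq_norm_sq]

/-- `S*S` is symmetric. [folklore] -/
private theorem inner_formOp_comm (S : W →ₗ[ℝ] F) (v w : W) : ⟪v, formOp S w⟫ = ⟪formOp S v, w⟫ := by
  rw [inner_formOp, ← real_inner_comm, ← inner_formOp, real_inner_comm]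

/-- No zero modes of S ⇒ `S*S` is injective, hence a unit of `End W`. [folklore] -/
private theorem isUnit_formOp {S : W →ₗ[ℝ] F} (hS : Function.Injective S) : IsUnit (formOp S) := by
  rw [LinearMap.isUnit_iff_ker_eq_bot, LinearMap.ker_eq_bot]
  intro v w hvw
  have h : formOp S (v - w) = 0 := by rw [map_sub, hvw, sub_self]
  have h2 : ‖S (v - w)‖ ^ 2 = 0 := by rw [← inner_formOp_self, h, inner_zero_right]
  have h3 : S (v - w) = 0 := by
    have := pow_eq_zero_iff (n := 2) (by norm_num) |>.1 h2
    exact norm_eq_zero.1 this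
  exact sub_eq_zero.1 (hS (by rw [h3, map_zero]))

/-- `(S*S)(S*S)⁻¹ = 1` without zero modes (the inverse in the operator formula for `G_{k,Ax}`). [cite: BalabanImbrieJaffe1985, (4.1.1) p.309] -/
theorem formOp_formInv {S : W →ₗ[ℝ] F} (hS : Function.Injective S) (w : W) : formOp S (formInv S w) = w := by
  have := Ring.mul_inverse_cancel _ (isUnit_formOp hS)
  simpa [formInv] using LinearMap.congr_fun this w

/-- **Completing the square** (the step from (4.1.1) to "the second moment"): with `v₀ = (S*S)⁻¹b`,
`−½‖Sw‖² + ⟨w, b⟩ = −½‖S(w − v₀)‖² + ½⟨b, (S*S)⁻¹b⟩`. [cite: BalabanImbrieJaffe1985, (4.1.1) p.309] -/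
theorem complete_square {S : W →ₗ[ℝ] F} (hS : Function.Injective S) (b w : W) :
    -(1 / 2) * ‖S w‖ ^ 2 + ⟪w, b⟫ = -(1 / 2) * ‖S (w - formInv S b)‖ ^ 2 + (1 / 2) * ⟪b, formInv S b⟫ := by
  set v₀ := formInv S b with hv₀
  have h1 : ⟪S w, S v₀⟫ = ⟪w, b⟫ := by rw [← inner_formOp, formOp_formInv hS]
  have h2 : ‖S v₀‖ ^ 2 = ⟪b, v₀⟫ := by
    rw [← inner_formOp_self, inner_formOp_comm, formOp_formInv hS]
  have h3 : ‖S (w - v₀)‖ ^ 2 = ‖S w‖ ^ 2 - 2 * ⟪S w, S v₀⟫ + ‖S v₀‖ ^ 2 := by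
    rw [map_sub, ← real_inner_self_eq_norm_sq, ← real_inner_self_eq_norm_sq, ← real_inner_self_eq_norm_sq,
      inner_sub_left, inner_sub_right, inner_sub_right, real_inner_comm (S v₀) (S w)]
    ring
  rw [h3, h1, h2]
  ring

omit [FiniteDimensional ℝ F] in
/-- No zero modes ⇒ a coercivity constant: `‖w‖ ≤ K‖Sw‖`. [folklore] -/
private theorem exists_norm_le_mul {S : W →ₗ[ℝ] F} (hS : Function.Injective S) : ∃ K : ℝ, 0 ≤ K ∧ ∀ w, ‖w‖ ≤ K * ‖S w‖ := by
  let e : W ≃L[ℝ] LinearMap.range S := (LinearEquiv.ofInjective S hS).toContinuousLinearEquiv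
  refine ⟨‖(e.symm : LinearMap.range S →L[ℝ] W)‖₊, NNReal.coe_nonneg _, fun w => ?_⟩
  have h := e.antilipschitz.le_mul_dist w 0
  rw [dist_zero_right, map_zero, dist_zero_right] at h
  exact h

variable [MeasurableSpace W] [BorelSpace W]

omit [FiniteDimensional ℝ F] in
/-- **Convergence** (*"the integral (4.1.1) is convergent also for noncompact gauge fields"*): without zero modes
`w ↦ e^{−½‖Sw‖²}` is integrable for the volume of W. [cite: BalabanImbrieJaffe1985, §4.1 p.309] -/
theorem partition_integrable {S : W →ₗ[ℝ] F} (hS : Function.Injective S) :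
    Integrable (fun w : W => Real.exp (-(1 / 2) * ‖S w‖ ^ 2)) := by
  obtain ⟨K, hK0, hK⟩ := exists_norm_le_mul hS
  -- Gaussian majorant e^{−c‖w‖²}, c = ½/(K+1)²
  set c : ℝ := 1 / 2 / (K + 1) ^ 2 with hc
  have hcpos : 0 < c := by positivity
  have hgauss : Integrable (fun w : W => Real.exp (-c * ‖w‖ ^ 2)) := by
    have h := GaussianFourier.integrable_cexp_neg_mul_sq_norm_add (V := W) (b := (c : ℂ))
      (by simpa using hcpos) 0 0
    have h' := h.norm
    refine h'.congr (Filter.Eventually.of_forall fun w => ?_)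
    simp only [zero_mul, add_zero, Complex.norm_exp]
    congr 1
    have : (-(c : ℂ) * ((‖w‖ : ℝ) : ℂ) ^ 2) = ((-c * ‖w‖ ^ 2 : ℝ) : ℂ) := by push_cast; ring
    rw [this, Complex.ofReal_re]
  have hcont : Continuous fun w : W => Real.exp (-(1 / 2) * ‖S w‖ ^ 2) := by
    have := S.continuous_of_finiteDimensional
    fun_prop
  refine hgauss.mono' hcont.aestronglyMeasurable (Filter.Eventually.of_forall fun w => ?_)
  rw [Real.norm_eq_abs, abs_of_pos (Real.exp_pos _), Real.exp_le_exp]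
  have h1 : ‖w‖ ≤ (K + 1) * ‖S w‖ := (hK w).trans (by nlinarith [norm_nonneg (S w)])
  have h2 : ‖w‖ ^ 2 ≤ (K + 1) ^ 2 * ‖S w‖ ^ 2 := by
    rw [← mul_pow]; exact pow_le_pow_left₀ (norm_nonneg _) h1 2
  have h3 : c * ‖w‖ ^ 2 ≤ 1 / 2 * ‖S w‖ ^ 2 := by
    rw [hc]
    have hK1 : 0 < (K + 1) ^ 2 := by positivity
    calc 1 / 2 / (K + 1) ^ 2 * ‖w‖ ^ 2 ≤ 1 / 2 / (K + 1) ^ 2 * ((K + 1) ^ 2 * ‖S w‖ ^ 2) := by gcongr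
      _ = 1 / 2 * ‖S w‖ ^ 2 := by field_simp
  linarith

omit [FiniteDimensional ℝ F] in
/-- `Z > 0`. [cite: BalabanImbrieJaffe1985, §4.1 p.309] -/
theorem partition_pos {S : W →ₗ[ℝ] F} (hS : Function.Injective S) :
    0 < ∫ w : W, Real.exp (-(1 / 2) * ‖S w‖ ^ 2) :=
  integral_exp_pos (partition_integrable hS)

/-- **The Gaussian source identity** (the content of (4.1.1) as a definition of a second moment): for S without zero modes,
`∫_W e^{−½‖Sw‖² + ⟨w,b⟩} dw = e^{½⟨b,(S*S)⁻¹b⟩} · ∫_W e^{−½‖Sw‖²} dw`. [cite: BalabanImbrieJaffe1985, (4.1.1) p.309] -/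
theorem gaussian_source {S : W →ₗ[ℝ] F} (hS : Function.Injective S) (b : W) :
    ∫ w : W, Real.exp (-(1 / 2) * ‖S w‖ ^ 2 + ⟪w, b⟫) =
      Real.exp ((1 / 2) * ⟪b, formInv S b⟫) * ∫ w : W, Real.exp (-(1 / 2) * ‖S w‖ ^ 2) := by
  set v₀ := formInv S b
  have hsq : ∀ w, Real.exp (-(1 / 2) * ‖S w‖ ^ 2 + ⟪w, b⟫) =
      Real.exp ((1 / 2) * ⟪b, formInv S b⟫) * Real.exp (-(1 / 2) * ‖S (w - v₀)‖ ^ 2) := by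
    intro w
    rw [complete_square hS, ← Real.exp_add, add_comm]
  simp_rw [hsq]
  rw [integral_const_mul]
  congr 1
  have h := integral_add_left_eq_self (μ := (volume : Measure W))
    (fun w : W => Real.exp (-(1 / 2) * ‖S w‖ ^ 2)) (-v₀)
  simp only [neg_add_eq_sub] at h
  exact h

/-- The sourced integrand of (4.1.1) is integrable too (a translate of the J = 0 one): *"the integral (4.1.1) is convergent"*.
[cite: BalabanImbrieJaffe1985, §4.1 p.309] -/
theorem source_integrable {S : W →ₗ[ℝ] F} (hS : Function.Injective S) (b : W) :
    Integrable (fun w : W => Real.exp (-(1 / 2) * ‖S w‖ ^ 2 + ⟪w, b⟫)) := by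
  have hsq : (fun w : W => Real.exp (-(1 / 2) * ‖S w‖ ^ 2 + ⟪w, b⟫)) = fun w =>
      Real.exp ((1 / 2) * ⟪b, formInv S b⟫) * Real.exp (-(1 / 2) * ‖S (w - formInv S b)‖ ^ 2) := by
    funext w
    rw [complete_square hS, ← Real.exp_add, add_comm]
  rw [hsq]
  exact ((partition_integrable hS).comp_sub_right (formInv S b)).const_mul _

end Gaussian

/-! ## §2  (4.1.1): the axial gauge propagator as a constrained Gaussian second moment -/

section Propagator

variable {E F : Type*} [NormedAddCommGroup E] [InnerProductSpace ℝ E] [FiniteDimensional ℝ E]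
  [MeasurableSpace E] [BorelSpace E]
  [NormedAddCommGroup F] [InnerProductSpace ℝ F] [FiniteDimensional ℝ F]

/-- `Z_{k,Ax} = ∫𝒟A δ(Q_kA)δ_{k,Ax}(A) exp(−½‖∂A‖²)` — (4.1.1) at J = 0 (*"the normalization factor Z_{k,Ax} can be computed by
setting J = 0"*): the integral over the constraint subspace `V` (the support of the two delta functions) of `e^{−½‖DA‖²}`, `D` the
curl, for the volume of `V`. [cite: BalabanImbrieJaffe1985, (4.1.1) p.309] -/
def Z (V : Submodule ℝ E) (D : E →ₗ[ℝ] F) : ℝ :=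
  ∫ v : V, Real.exp (-(1 / 2) * ‖D (v : E)‖ ^ 2)

/-- `∫𝒟A δ(Q_kA)δ_{k,Ax}(A) exp(−½‖∂A‖² + ⟨A, J⟩)` — the right member of (4.1.1) before normalization, for a source `J`.
[cite: BalabanImbrieJaffe1985, (4.1.1) p.309] -/
def gen (V : Submodule ℝ E) (D : E →ₗ[ℝ] F) (J : E) : ℝ :=
  ∫ v : V, Real.exp (-(1 / 2) * ‖D (v : E)‖ ^ 2 + ⟪(v : E), J⟫)

/-- **(4.1.1) as printed — the DEFINING property of `G_{k,Ax}`**: *"Define G_{k,Ax} by the functional integral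
exp(½⟨J, G_{k,Ax}J⟩) = Z_{k,Ax}^{−1} ∫𝒟Aδ(Q_kA)δ_{k,Ax}(A)exp(−½‖∂A‖² + ⟨A,J⟩). (4.1.1)"*, for every source J.
[cite: BalabanImbrieJaffe1985, (4.1.1) p.309] -/
def IsAxialPropagator (V : Submodule ℝ E) (D : E →ₗ[ℝ] F) (G : E →ₗ[ℝ] E) : Prop :=
  ∀ J : E, Real.exp ((1 / 2) * ⟪J, G J⟫) = (Z V D)⁻¹ * gen V D J

/-- **An operator-theoretic formula for `G_{k,Ax}`** (*"the second moment of the measure exp(−½‖∂A‖²), restricted to the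
space of gauge fields which satisfy the k-th axial gauge condition and condition on the k-th average fields vanishing"*; the
paper adds *"We do not know a simple operator theoretic definition of G_{k,Ax}"*): `ι_V (ι_V* D*D ι_V)⁻¹ ι_V*`, with `ι_V` the
inclusion of the constraint subspace and `*` the ℓ²-adjoint. [cite: BalabanImbrieJaffe1985, (4.1.1) p.309] -/
def axialPropagator (V : Submodule ℝ E) (D : E →ₗ[ℝ] F) : E →ₗ[ℝ] E :=
  V.subtype ∘ₗ formInv (D ∘ₗ V.subtype) ∘ₗ LinearMap.adjoint V.subtype

/-- **(4.1.1) holds for the operator formula, and the integral converges, when ∂ has no zero modes on the constraint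
subspace** (the p. 309 claim, kernel-proved for k = 1 on the ℤ^d corner-block carriers in `…BIJ85NoZeroModes309Proof`).
[cite: BalabanImbrieJaffe1985, (4.1.1) p.309] -/
theorem isAxialPropagator_axialPropagator (V : Submodule ℝ E) (D : E →ₗ[ℝ] F)
    (hD : ∀ v : V, D (v : E) = 0 → v = 0) :
    IsAxialPropagator V D (axialPropagator V D) ∧ 0 < Z V D := by
  set S : V →ₗ[ℝ] F := D ∘ₗ V.subtype with hS
  have hSinj : Function.Injective S := by
    intro v w h
    have : S (v - w) = 0 := by rw [map_sub, h, sub_self]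
    exact sub_eq_zero.1 (hD _ this)
  have hZ : Z V D = ∫ v : V, Real.exp (-(1 / 2) * ‖S v‖ ^ 2) := rfl
  have hZpos : 0 < Z V D := by rw [hZ]; exact partition_pos hSinj
  refine ⟨fun J => ?_, hZpos⟩
  have hgen : gen V D J = ∫ v : V, Real.exp (-(1 / 2) * ‖S v‖ ^ 2 + ⟪v, LinearMap.adjoint V.subtype J⟫) := by
    unfold gen
    refine integral_congr_ae (Filter.Eventually.of_forall fun v => ?_)
    simp only [hS, LinearMap.comp_apply, Submodule.subtype_apply, LinearMap.adjoint_inner_right]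
  have hquad : ⟪J, axialPropagator V D J⟫ = ⟪LinearMap.adjoint V.subtype J, formInv S (LinearMap.adjoint V.subtype J)⟫ := by
    unfold axialPropagator
    rw [LinearMap.comp_apply, LinearMap.comp_apply, ← LinearMap.adjoint_inner_left]
  rw [hgen, gaussian_source hSinj, hquad, ← hZ, mul_comm (Real.exp _) (Z V D), ← mul_assoc, inv_mul_cancel₀ hZpos.ne',
    one_mul]

omit [FiniteDimensional ℝ F] in
/-- (4.1.1) determines the quadratic form `⟨J, G J⟩` (hence the symmetric part of G): two propagators in the sense of
(4.1.1) have the same quadratic form. [cite: BalabanImbrieJaffe1985, (4.1.1) p.309] -/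
theorem quadForm_eq_of_isAxialPropagator {V : Submodule ℝ E} {D : E →ₗ[ℝ] F} {G G' : E →ₗ[ℝ] E}
    (hG : IsAxialPropagator V D G) (hG' : IsAxialPropagator V D G') (J : E) : ⟪J, G J⟫ = ⟪J, G' J⟫ := by
  have h := (hG J).trans (hG' J).symm
  have := Real.exp_injective h
  linarith

end Propagator

/-! ## §3  (4.1.2): the k-scale axial gauge and the support of `δ(Q_kA)δ_{k,Ax}(A)` on the V1 lattice calculus -/

section Delta

open Literature.MathematicalPhysics.QuantumFieldTheory.Balaban1983to89
open LatticeFieldCalculus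

variable {P : Params} {V : Type*} [AddCommGroup V] [Module ℝ V]

/-- **(4.1.2)** verbatim: *"δ_{k,Ax}(A) ≡ Π_{j=0}^{k−1} δ_{Ax}(Q_jA). (4.1.2) The j^th factor in the product acts on the L^jη = L^{j−k}
lattice. It sets bond field averages Q_jA to zero on contours Γ_{yx} defined in the L^jη lattice in the same way that the axial
gauge was fixed in Sect. 3 on contours in the unit lattice."* — the support of the product of delta functions, as a predicate on
η-lattice bond fields `A : VecField P 0 V` (`Q_j` = `bondAvgIter j`, `δ_{Ax}` ↔ `IsAxial`). [cite: BalabanImbrieJaffe1985, (4.1.2) p.309] -/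
def deltaAx (k : ℕ) (A : VecField P 0 V) : Prop :=
  ∀ j, j < k → IsAxial (bondAvgIter j A)

/-- `δ_{0,Ax} ≡ 1` (empty product). [cite: BalabanImbrieJaffe1985, (4.1.2) p.309] -/
theorem deltaAx_zero (A : VecField P 0 V) : deltaAx 0 A := fun _ h => absurd h (Nat.not_lt_zero _)

/-- **Product identity** `δ_{k+1,Ax}(A) = δ_{k,Ax}(A)·δ_{Ax}(Q_kA)`. [cite: BalabanImbrieJaffe1985, (4.1.2) p.309] -/
theorem deltaAx_succ (k : ℕ) (A : VecField P 0 V) : deltaAx (k + 1) A ↔ deltaAx k A ∧ IsAxial (bondAvgIter k A) := by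
  constructor
  · intro h
    exact ⟨fun j hj => h j (Nat.lt_succ_of_lt hj), h k (Nat.lt_succ_self k)⟩
  · rintro ⟨h1, h2⟩ j hj
    rcases Nat.lt_succ_iff_lt_or_eq.1 hj with hj' | rfl
    · exact h1 j hj'
    · exact h2

-- `Q_0 = 1` and **`Q_k = (Q)^k`** (`Q_{k+1} = Q ∘ Q_k`, *"The averaging operator Q_k is the k-fold composition of the 1-step
-- averaging operators Q for bond variables, Q_k = (Q)^k"*, p. 309) hold by `rfl` for `LatticeFieldCalculus.bondAvgIter` and are
-- the tree's `B5Eq120IterProof.bondAvgIter_zero` / `B5Eq120IterProof.bondAvgIter_succ` ([Balaban1984PropagatorsI] (1.18));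
-- not re-declared here (gate dedup) — used below definitionally.

/-- `δ_{1,Ax} = δ_{Ax}`: the first factor is the axial gauge of Sect. 3 on the η-lattice field itself. [cite: BalabanImbrieJaffe1985, (4.1.2) p.309] -/
theorem deltaAx_one (A : VecField P 0 V) : deltaAx 1 A ↔ IsAxial A := by
  rw [deltaAx_succ]
  -- `bondAvgIter 0 A = A` definitionally
  exact ⟨fun h => h.2, fun h => ⟨deltaAx_zero A, h⟩⟩

/-- Restriction: `δ_{k,Ax}(A)` implies `δ_{j,Ax}(A)` for `j ≤ k`. [cite: BalabanImbrieJaffe1985, (4.1.2) p.309] -/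
theorem deltaAx_mono {j k : ℕ} (hjk : j ≤ k) {A : VecField P 0 V} (h : deltaAx k A) : deltaAx j A :=
  fun i hi => h i (lt_of_lt_of_le hi hjk)

/-! ### Linearity of the averages and of the contour functionals (the constraint set is a linear subspace) -/

section Linear

variable {j : ℕ}

omit [Module ℝ V] in
/-- `A([x,x+ne_μ])` is additive in A. [cite: Balaban1984PropagatorsI, (1.8) p.19] -/
theorem segSum_add (A B : VecField P j V) (x : Site P j) (μ : Fin P.d) (n : ℕ) :
    segSum (A + B) x μ n = segSum A x μ n + segSum B x μ n := by
  simp [segSum, Finset.sum_add_distrib]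

/-- `A([x,x+ne_μ])` is homogeneous in A. [cite: Balaban1984PropagatorsI, (1.8) p.19] -/
theorem segSum_smul (c : ℝ) (A : VecField P j V) (x : Site P j) (μ : Fin P.d) (n : ℕ) :
    segSum (c • A) x μ n = c • segSum A x μ n := by
  simp [segSum, Finset.smul_sum]

/-- `Q` is additive. [cite: Balaban1984PropagatorsI, (1.11) p.19] -/
theorem bondAvg_add (A B : VecField P j V) : bondAvg (A + B) = bondAvg A + bondAvg B := by
  funext c
  simp [bondAvg, segSum_add, Finset.sum_add_distrib, smul_add]

/-- `Q` is homogeneous. [cite: Balaban1984PropagatorsI, (1.11) p.19] -/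
theorem bondAvg_smul (c : ℝ) (A : VecField P j V) : bondAvg (c • A) = c • bondAvg A := by
  funext b
  simp [bondAvg, segSum_smul, ← Finset.smul_sum, smul_comm c]

/-- `Q 0 = 0`. [cite: Balaban1984PropagatorsI, (1.11) p.19] -/
theorem bondAvg_zero : bondAvg (0 : VecField P j V) = 0 := by
  have h := bondAvg_smul (P := P) (j := j) (V := V) 0 0
  simpa using h

/-- `Q_k` is additive. [cite: BalabanImbrieJaffe1985, (4.1.1) p.309] -/
theorem bondAvgIter_add (k : ℕ) (A B : VecField P 0 V) :
    bondAvgIter k (A + B) = bondAvgIter k A + bondAvgIter k B := by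
  induction k with
  | zero => rfl
  | succ k ih =>
    show bondAvg (bondAvgIter k (A + B)) = bondAvg (bondAvgIter k A) + bondAvg (bondAvgIter k B)
    rw [ih, bondAvg_add]

/-- `Q_k` is homogeneous. [cite: BalabanImbrieJaffe1985, (4.1.1) p.309] -/
theorem bondAvgIter_smul (k : ℕ) (c : ℝ) (A : VecField P 0 V) : bondAvgIter k (c • A) = c • bondAvgIter k A := by
  induction k with
  | zero => rfl
  | succ k ih =>
    show bondAvg (bondAvgIter k (c • A)) = c • bondAvg (bondAvgIter k A)
    rw [ih, bondAvg_smul]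

/-- `Q_k 0 = 0`. [cite: BalabanImbrieJaffe1985, (4.1.1) p.309] -/
theorem bondAvgIter_map_zero (k : ℕ) : bondAvgIter k (0 : VecField P 0 V) = 0 := by
  have h := bondAvgIter_smul (P := P) (V := V) k 0 0
  simpa using h

omit [Module ℝ V] in
/-- The signed run sums are additive in A. [cite: Balaban1984PropagatorsI, (1.7) p.18] -/
theorem runSum_add (A B : VecField P j V) (x : Site P j) (μ : Fin P.d) (n : ℤ) :
    runSum (A + B) x μ n = runSum A x μ n + runSum B x μ n := by
  cases n with
  | ofNat n => simp [runSum, Finset.sum_add_distrib]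
  | negSucc n => simp [runSum, Finset.sum_add_distrib]; abel

/-- The signed run sums are homogeneous in A. [cite: Balaban1984PropagatorsI, (1.7) p.18] -/
theorem runSum_smul (c : ℝ) (A : VecField P j V) (x : Site P j) (μ : Fin P.d) (n : ℤ) :
    runSum (c • A) x μ n = c • runSum A x μ n := by
  cases n with
  | ofNat n => simp [runSum, Finset.smul_sum]
  | negSucc n => simp [runSum, Finset.smul_sum, smul_neg]

omit [Module ℝ V] in
/-- `A(Γ_{y,x})` is additive in A. [cite: Balaban1984PropagatorsI, (1.7) p.18] -/
theorem stairSum_add (A B : VecField P j V) (y x : Site P j) :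
    stairSum (A + B) y x = stairSum A y x + stairSum B y x := by
  simp [stairSum, runSum_add, Finset.sum_add_distrib]

/-- `A(Γ_{y,x})` is homogeneous in A. [cite: Balaban1984PropagatorsI, (1.7) p.18] -/
theorem stairSum_smul (c : ℝ) (A : VecField P j V) (y x : Site P j) :
    stairSum (c • A) y x = c • stairSum A y x := by
  simp [stairSum, runSum_smul, Finset.smul_sum]

omit [Module ℝ V] in
/-- The axial gauge condition `A(Γ_{y,x}) = 0` is closed under addition. [cite: BalabanImbrieJaffe1985, (3.4) p.306] -/
theorem isAxial_add {A B : VecField P j V} (hA : IsAxial A) (hB : IsAxial B) : IsAxial (A + B) :=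
  fun y r hr => by rw [stairSum_add, hA y r hr, hB y r hr, add_zero]

/-- … and under scalars. [cite: BalabanImbrieJaffe1985, (3.4) p.306] -/
theorem isAxial_smul (c : ℝ) {A : VecField P j V} (hA : IsAxial A) : IsAxial (c • A) :=
  fun y r hr => by rw [stairSum_smul, hA y r hr, smul_zero]

/-- The zero field is in the axial gauge. [cite: BalabanImbrieJaffe1985, (3.4) p.306] -/
theorem isAxial_zero : IsAxial (0 : VecField P j V) := by
  intro y r hr
  have h := stairSum_smul (P := P) (j := j) (V := V) 0 0 (emb y) (Site.blockSite y r)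
  simpa using h

end Linear

/-- **The support of `δ(Q_kA)δ_{k,Ax}(A)` in (4.1.1) is a linear subspace** of the η-lattice bond fields: *"the subspace of
gauge fields satisfying Q_kA = 0 and satisfying the axial gauge condition"* (p. 309) — the domain of integration of (4.1.1),
i.e. the `V` of §2. [cite: BalabanImbrieJaffe1985, (4.1.1)–(4.1.2) p.309] -/
def constraint411 (k : ℕ) : Submodule ℝ (VecField P 0 V) where
  carrier := {A | bondAvgIter k A = 0 ∧ deltaAx k A}
  zero_mem' := ⟨bondAvgIter_map_zero k, fun j _ => by rw [bondAvgIter_map_zero]; exact isAxial_zero⟩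
  add_mem' := by
    rintro A B ⟨hA1, hA2⟩ ⟨hB1, hB2⟩
    refine ⟨by rw [bondAvgIter_add, hA1, hB1, add_zero], fun j hj => ?_⟩
    rw [bondAvgIter_add]
    exact isAxial_add (hA2 j hj) (hB2 j hj)
  smul_mem' := by
    rintro c A ⟨hA1, hA2⟩
    refine ⟨by rw [bondAvgIter_smul, hA1, smul_zero], fun j hj => ?_⟩
    rw [bondAvgIter_smul]
    exact isAxial_smul c (hA2 j hj)

/-- Membership in the constraint subspace, unfolded: `Q_kA = 0` and `δ_{k,Ax}(A)`. [cite: BalabanImbrieJaffe1985, (4.1.1)–(4.1.2) p.309] -/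
theorem mem_constraint411 (k : ℕ) (A : VecField P 0 V) :
    A ∈ (constraint411 k : Submodule ℝ (VecField P 0 V)) ↔ bondAvgIter k A = 0 ∧ deltaAx k A := Iff.rfl

end Delta

/-! ## §4  (4.1.1) on the tori of the series' lattice calculus: `G_{k,Ax}` for the η-bond fields `VecField P 0 ℝ` -/

section Torus

open Literature.MathematicalPhysics.QuantumFieldTheory.Balaban1983to89
open LatticeFieldCalculus

variable {P : Params}

/-- The η-lattice bond fields `VecField P 0 ℝ` as a Euclidean space (unit ℓ² pairing `Σ_b A_b J_b`; the printed pairing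
`⟨A, J⟩ = Σ_b η^d A_b J_b` is `bondPairing w`, `w = η^d`, and enters below through the source `w • J`). [folklore] -/
abbrev BondSpace (P : Params) : Type := EuclideanSpace ℝ (PBond P 0)

/-- The η-lattice plaquette functions as a Euclidean space. [folklore] -/
abbrev PlaqSpace (P : Params) : Type := EuclideanSpace ℝ (Plaq P 0)

/-- The identification of a bond field with the corresponding vector of the Euclidean space `BondSpace P`. [folklore] -/
def toE (P : Params) : VecField P 0 ℝ ≃ₗ[ℝ] BondSpace P :=
  (WithLp.linearEquiv 2 ℝ (PBond P 0 → ℝ)).symm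

/-- Components are unchanged by the identification. [folklore] -/
@[simp] private theorem toE_apply (A : VecField P 0 ℝ) (b : PBond P 0) : toE P A b = A b := rfl

/-- Components are unchanged by the inverse identification. [folklore] -/
@[simp] private theorem toE_symm_apply (v : BondSpace P) (b : PBond P 0) : (toE P).symm v b = v b := rfl

/-- `⟨A, B⟩_{ℓ²} = Σ_b A_b B_b` under the identification. [folklore] -/
private theorem inner_toE (A B : VecField P 0 ℝ) : ⟪toE P A, toE P B⟫ = ∑ b : PBond P 0, A b * B b := by
  simp [PiLp.inner_apply, mul_comm]

/-- `∂` is additive (the tree's `curl_add`, for `A + B`). [cite: Balaban1984PropagatorsI, (1.2) p.18] -/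
private theorem curl_add' (c : ℝ) (A B : VecField P 0 ℝ) (p : Plaq P 0) :
    curl c (A + B) p = curl c A p + curl c B p :=
  curl_add c A B p

/-- `∂` is homogeneous. [cite: Balaban1984PropagatorsI, (1.2) p.18] -/
private theorem curl_smul' (c r : ℝ) (A : VecField P 0 ℝ) (p : Plaq P 0) :
    curl c (r • A) p = r * curl c A p := by
  simp only [curl, Pi.smul_apply, smul_eq_mul]
  ring

/-- The weighted plaquette variable `A ↦ (√w · (∂A)(p))_p` as a linear map on functions. [cite: Balaban1984PropagatorsI, (1.2) p.18] -/
def curlFun (w c : ℝ) : VecField P 0 ℝ →ₗ[ℝ] (Plaq P 0 → ℝ) where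
  toFun A := fun p => Real.sqrt w * curl c A p
  map_add' A B := by
    funext p
    rw [Pi.add_apply, curl_add', mul_add]
  map_smul' r A := by
    funext p
    simp only [RingHom.id_apply, Pi.smul_apply, smul_eq_mul, curl_smul']
    ring

/-- **∂ of (4.1.1) with the volume weight**: `A ↦ (√w · (∂A)(p))_p`, `w = η^d`, lattice factor `c = η⁻¹` inside `∂`
(`LatticeFieldCalculus.curl`), so that `½‖curlOp w c A‖² = curlAction w c A = ½ Σ_p η^d |(∂A)(p)|²` is the exponent
`½‖∂A‖²` of (4.1.1). [cite: BalabanImbrieJaffe1985, (4.1.1) p.309] -/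
def curlOp (w c : ℝ) : BondSpace P →ₗ[ℝ] PlaqSpace P :=
  (WithLp.linearEquiv 2 ℝ (Plaq P 0 → ℝ)).symm.toLinearMap ∘ₗ curlFun w c ∘ₗ (toE P).symm.toLinearMap

/-- Components of `curlOp`. [folklore] -/
@[simp] private theorem curlOp_apply (w c : ℝ) (v : BondSpace P) (p : Plaq P 0) :
    curlOp w c v p = Real.sqrt w * curl c ((toE P).symm v) p := rfl

/-- `½‖curlOp w c A‖² = curlAction w c A` (= ½ Σ_p η^d |(∂A)(p)|², the tree's (1.3) of [Balaban1984PropagatorsI]).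
[cite: BalabanImbrieJaffe1985, (4.1.1) p.309] -/
theorem half_norm_curlOp_sq {w : ℝ} (hw : 0 ≤ w) (c : ℝ) (v : BondSpace P) :
    (1 / 2) * ‖curlOp w c v‖ ^ 2 = curlAction w c ((toE P).symm v) := by
  unfold curlAction
  rw [EuclideanSpace.norm_sq_eq]
  congr 1
  refine Finset.sum_congr rfl fun p _ => ?_
  rw [curlOp_apply, Real.norm_eq_abs, Real.norm_eq_abs, sq_abs, sq_abs, mul_pow, Real.sq_sqrt hw]

/-- `⟨A, w • J⟩_{ℓ²} = bondPairing w A J = Σ_b η^d A_b J_b` — the printed source term `⟨A, J⟩` of (4.1.1).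
[cite: BalabanImbrieJaffe1985, (4.1.1) p.309] -/
theorem inner_toE_smul (w : ℝ) (A J : VecField P 0 ℝ) : ⟪toE P A, toE P (w • J)⟫ = bondPairing w A J := by
  rw [inner_toE]
  unfold bondPairing
  refine Finset.sum_congr rfl fun b _ => ?_
  rw [Pi.smul_apply, smul_eq_mul]
  ring

/-- **The domain of integration of (4.1.1) on the torus**: the constraint subspace `δ(Q_kA)δ_{k,Ax}(A)` = `constraint411 k`
of §3, as a subspace of the Euclidean space `BondSpace P`. [cite: BalabanImbrieJaffe1985, (4.1.1)–(4.1.2) p.309] -/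
def V411 (P : Params) (k : ℕ) : Submodule ℝ (BondSpace P) :=
  (constraint411 (P := P) (V := ℝ) k).map (toE P).toLinearMap

/-- Membership in `V411`: the underlying bond field satisfies `Q_kA = 0` and `δ_{k,Ax}(A)`. [cite: BalabanImbrieJaffe1985, (4.1.1)–(4.1.2) p.309] -/
theorem mem_V411 (k : ℕ) (v : BondSpace P) :
    v ∈ V411 P k ↔ bondAvgIter k ((toE P).symm v) = 0 ∧ deltaAx k ((toE P).symm v) := by
  unfold V411
  rw [Submodule.mem_map]
  constructor
  · rintro ⟨A, hA, rfl⟩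
    rw [LinearEquiv.coe_toLinearMap, LinearEquiv.symm_apply_apply]
    exact hA
  · intro h
    exact ⟨(toE P).symm v, h, by rw [LinearEquiv.coe_toLinearMap, LinearEquiv.apply_symm_apply]⟩

/-- **`G_{k,Ax}` on the torus** — the operator formula of §2 for the η-bond fields with the weighted pairing
`⟨A, J⟩ = Σ_b η^d A_b J_b` (`w = η^d`) and `‖∂A‖² = Σ_p η^d |(∂A)(p)|²` (`c = η⁻¹` in `∂`), on the constraint subspace
`δ(Q_kA)δ_{k,Ax}(A)`: `G = w · ι⁻¹ ∘ (ι_V (ι_V* ∂*∂ ι_V)⁻¹ ι_V*) ∘ ι`. [cite: BalabanImbrieJaffe1985, (4.1.1) p.309] -/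
def torusPropagator (w c : ℝ) (k : ℕ) : VecField P 0 ℝ →ₗ[ℝ] VecField P 0 ℝ :=
  w • ((toE P).symm.toLinearMap ∘ₗ axialPropagator (V411 P k) (curlOp (P := P) w c) ∘ₗ (toE P).toLinearMap)

/-- `Z_{k,Ax}` on the torus is `∫ e^{−½Σ_p η^d|(∂A)(p)|²}` over the constraint subspace. [cite: BalabanImbrieJaffe1985, (4.1.1) p.309] -/
theorem Z_torus {w : ℝ} (hw : 0 ≤ w) (c : ℝ) (k : ℕ) :
    Z (V411 P k) (curlOp (P := P) w c) = ∫ v : V411 P k, Real.exp (-curlAction w c ((toE P).symm (v : BondSpace P))) := by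
  unfold Z
  refine integral_congr_ae (Filter.Eventually.of_forall fun v => ?_)
  simp only [neg_mul, ← half_norm_curlOp_sq hw c (v : BondSpace P)]

/-- **(4.1.1) on the torus, PROVED for the operator formula** (given the p. 309 no-zero-modes claim as the hypothesis `hD`:
∂A = 0, Q_kA = 0 and δ_{k,Ax}(A) force A = 0): for every source J,
`exp(½⟨J, G_{k,Ax}J⟩) = Z_{k,Ax}⁻¹ ∫_{Q_kA = 0, δ_{k,Ax}(A)} exp(−½‖∂A‖² + ⟨A, J⟩) dA`, with `⟨·,·⟩ = bondPairing w`
(`w = η^d > 0`), `½‖∂A‖² = curlAction w c A`, `dA` the volume of the constraint subspace, and `Z_{k,Ax} > 0`.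
[cite: BalabanImbrieJaffe1985, (4.1.1) p.309] -/
theorem eq411_torus {w : ℝ} (hw : 0 < w) (c : ℝ) (k : ℕ)
    (hD : ∀ A : VecField P 0 ℝ, A ∈ (constraint411 k : Submodule ℝ (VecField P 0 ℝ)) → (∀ p, curl c A p = 0) → A = 0)
    (J : VecField P 0 ℝ) :
    Real.exp ((1 / 2) * bondPairing w J (torusPropagator w c k J)) =
        (Z (V411 P k) (curlOp (P := P) w c))⁻¹ *
          ∫ v : V411 P k, Real.exp (-curlAction w c ((toE P).symm (v : BondSpace P)) +
            bondPairing w ((toE P).symm (v : BondSpace P)) J) ∧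
      0 < Z (V411 P k) (curlOp (P := P) w c) := by
  -- the no-zero-modes hypothesis, transported to the Euclidean space
  have hD' : ∀ v : V411 P k, curlOp (P := P) w c (v : BondSpace P) = 0 → v = 0 := by
    intro v hv
    have hmem := (mem_V411 k (v : BondSpace P)).1 v.2
    have hcurl : ∀ p, curl c ((toE P).symm (v : BondSpace P)) p = 0 := by
      intro p
      have h := congrArg (fun u : PlaqSpace P => u p) hv
      simp only [curlOp_apply] at h
      have hsw : Real.sqrt w ≠ 0 := (Real.sqrt_pos.2 hw).ne'
      simpa [hsw] using h
    have hA := hD _ ((mem_constraint411 k _).2 hmem) hcurl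
    have : (v : BondSpace P) = 0 := by
      rw [← (toE P).apply_symm_apply (v : BondSpace P), hA, map_zero]
    exact Subtype.ext this
  obtain ⟨h411, hZ⟩ := isAxialPropagator_axialPropagator (V411 P k) (curlOp (P := P) w c) hD'
  refine ⟨?_, hZ⟩
  have h := h411 (toE P (w • J))
  -- the quadratic form of the source
  set X : VecField P 0 ℝ := (toE P).symm (axialPropagator (V411 P k) (curlOp (P := P) w c) (toE P J)) with hX
  have hG : torusPropagator w c k J = w • X := by
    simp only [torusPropagator, hX, LinearMap.smul_apply, LinearMap.comp_apply, LinearEquiv.coe_toLinearMap]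
  have hGE : axialPropagator (V411 P k) (curlOp (P := P) w c) (toE P (w • J)) = toE P (w • X) := by
    rw [map_smul, map_smul, map_smul, hX, LinearEquiv.apply_symm_apply]
  have hlhs : ⟪toE P (w • J), axialPropagator (V411 P k) (curlOp (P := P) w c) (toE P (w • J))⟫ =
      bondPairing w J (torusPropagator w c k J) := by
    rw [hGE, hG, inner_toE]
    unfold bondPairing
    refine Finset.sum_congr rfl fun b _ => ?_
    simp only [Pi.smul_apply, smul_eq_mul]
    ring
  -- the integrand
  have hrhs : gen (V411 P k) (curlOp (P := P) w c) (toE P (w • J)) =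
      ∫ v : V411 P k, Real.exp (-curlAction w c ((toE P).symm (v : BondSpace P)) +
        bondPairing w ((toE P).symm (v : BondSpace P)) J) := by
    unfold gen
    refine integral_congr_ae (Filter.Eventually.of_forall fun v => ?_)
    have h1 : -(1 / 2) * ‖curlOp (P := P) w c (v : BondSpace P)‖ ^ 2 = -curlAction w c ((toE P).symm (v : BondSpace P)) := by
      rw [neg_mul, half_norm_curlOp_sq hw.le]
    have h2 : ⟪((v : BondSpace P)), toE P (w • J)⟫ = bondPairing w ((toE P).symm (v : BondSpace P)) J := by
      rw [← inner_toE_smul w, LinearEquiv.apply_symm_apply]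
    simp only [h1, h2]
  rw [← hlhs, ← hrhs]
  exact h

end Torus

end

end Literature.MathematicalPhysics.QuantumFieldTheory.BalabanImbrieJaffe1984to88.BIJ85AxialPropagator411
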